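import Mathlib
import Literature.Probability.LatticeModels.ProdBernoulliIndependence
import Literature.Probability.Percolation.ConditionalPositiveAssociation
import Literature.Probability.Percolation.ConditionalPositiveAssociationProofs
import Literature.Probability.Percolation.TwoClusterConditionalAssociation
import Literature.Probability.Percolation.PercolationProofs
import Literature.Probability.Percolation.ClusterBoundary
import HarnessLib

/-!
# Crux `PercNearOneGluing.NearOneGluing` (stmt-CriticalPhenomena-4574), line `bhk-dyadic-thinning` — stub `stub_bhkLogSupermodular`

Helper file for the crux skeleton `Cruxes/NearOneGluing/Lines/bhk-dyadic-thinning.lean` (lead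
prover-line-stmt-CriticalPhenomena-4574-0).  Proves exactly the registered stub signature; lands with
`--supports stmt-CriticalPhenomena-4574`.

## Content

van den Berg–Häggström–Kahn 2006 (RSA 29, 417–435; arXiv:math/0408176), **Theorem 1.1** for
EVENTS on the finite vertex set `Fin n`: for bond percolation `μ = prodBernoulli w` on
`Set (Sym2 (Fin n))`, a vertex `s`, vertex sets `X, Y ∌ s`, `R_W = {s ↮ W}` and events `A, B`
increasing and determined by the open edge cluster `C_s` (`ω ∈ A`, `C_s ω ⊆ C_s ω'` ⇒ `ω' ∈ A`),
`μ(A ∩ R_X) μ(B ∩ R_Y) ≤ μ(A ∩ B ∩ R_{X∩Y}) μ(R_{X∪Y})`.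

The tree contains the printed proof (induction on the vertex set + the Ahlswede–Daykin four
functions theorem) in FUNCTIONAL form, for percolation restricted to a vertex set `U`:
`Literature.Probability.Percolation.BHK2006.core` (file
`Literature/Probability/Percolation/ConditionalPositiveAssociationProofs.lean`), stated with the
finite weighted sums `∑ ω, weight w ω * (F (C_s^U ω) * 1_{R^U_X} ω)` for `F, G ≥ 0` increasing
functions of the cluster.  The events version is its special case `U = univ`,
`F = F_A := 1_{S_A}`, `S_A = {C | ∃ ω ∈ A, C_s ω ⊆ C}` (an increasing function of a set of edges with
`F_A (C_s ω) = 1_A ω` precisely because `A` is increasing and determined by `C_s`) and `G = F_B`;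
the weighted sums are the `prodBernoulli w`-probabilities (`BHK2006.integral_prodBernoulli_eq_sum`).
-/

namespace Summit.CriticalPhenomena.PercolationContinuityZ3.Theorems

open scoped BigOperators Classical
open MeasureTheory Set
open Literature.Probability.LatticeModels (prodBernoulli)
open Literature.Probability.Percolation (openConn measurableSet_openConn_holds)

section BHKEvents

open Literature.Probability.Percolation
open Literature.Probability.Percolation.BHK2006
open Literature.Probability.Percolation.DecisionTree (ind ind_of_mem ind_of_not_mem ind_nonneg)

variable {V : Type*}

/-- For `A` increasing and determined by `C_s`, the increasing function
`F_A = 1_{S_A}`, `S_A = {C | ∃ ω ∈ A, C_s ω ⊆ C}`, of a set of edges satisfies `F_A (C_s ω) = 1_A ω`.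
[cite: VandenbergHaggstromKahn2005, §1 p. 3 ("A is increasing and determined by the open cluster of s")] -/
theorem ind_setOf_exists_openEdgeCluster_subset {A : Set (BondConfig V)} {s : V}
    (hA : ∀ ω ω', ω ∈ A → openEdgeCluster ω s ⊆ openEdgeCluster ω' s → ω' ∈ A)
    (ω : BondConfig V) :
    ind {C : Set (Sym2 V) | ∃ ω' ∈ A, openEdgeCluster ω' s ⊆ C} (openEdgeCluster ω s) =
      ind A ω := by
  by_cases hω : ω ∈ A
  · have h1 : openEdgeCluster ω s ∈ {C : Set (Sym2 V) | ∃ ω' ∈ A, openEdgeCluster ω' s ⊆ C} :=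
      ⟨ω, hω, subset_rfl⟩
    rw [ind_of_mem hω, ind_of_mem h1]
  · have h1 : openEdgeCluster ω s ∉ {C : Set (Sym2 V) | ∃ ω' ∈ A, openEdgeCluster ω' s ⊆ C} := by
      rintro ⟨ω', hω', hsub⟩
      exact hω (hA ω' ω hω' hsub)
    rw [ind_of_not_mem hω, ind_of_not_mem h1]

/-- `F_A = 1_{S_A}` is increasing in the set of edges (`S_A` is an upper set). [folklore] -/
theorem monotone_ind_setOf_exists_openEdgeCluster_subset (A : Set (BondConfig V)) (s : V) :
    Monotone fun C : Set (Sym2 V) => ind {C : Set (Sym2 V) | ∃ ω ∈ A, openEdgeCluster ω s ⊆ C} C := by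
  intro C C' hCC'
  dsimp only
  by_cases h : C ∈ {C : Set (Sym2 V) | ∃ ω ∈ A, openEdgeCluster ω s ⊆ C}
  · obtain ⟨ω, hω, hsub⟩ := h
    have h1 : C ∈ {C : Set (Sym2 V) | ∃ ω ∈ A, openEdgeCluster ω s ⊆ C} := ⟨ω, hω, hsub⟩
    have h2 : C' ∈ {C : Set (Sym2 V) | ∃ ω ∈ A, openEdgeCluster ω s ⊆ C} :=
      ⟨ω, hω, hsub.trans hCC'⟩
    rw [ind_of_mem h1, ind_of_mem h2]
  · rw [ind_of_not_mem h]
    exact ind_nonneg _ _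

variable [Fintype V]

/-- The `prodBernoulli w`-probability of an event on the finite configuration space is the
weighted sum of its indicator. [folklore] -/
theorem prodBernoulli_real_eq_sum_weight_ind (w : Sym2 V → unitInterval) (D : Set (BondConfig V)) :
    (prodBernoulli w).real D = ∑ ω, weight (fun e => (w e : ℝ)) ω * ind D ω := by
  rw [← integral_indicator_one (MeasurableSet.of_discrete (s := D)),
    integral_prodBernoulli_eq_sum]
  refine Finset.sum_congr rfl fun ω _ => ?_
  by_cases hω : ω ∈ D
  · rw [Set.indicator_of_mem hω, ind_of_mem hω, Pi.one_apply]
  · rw [Set.indicator_of_notMem hω, ind_of_not_mem hω, mul_zero]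

/-- **van den Berg–Häggström–Kahn (2006), Theorem 1.1, for events**, on an arbitrary finite
vertex type: for `A, B` increasing and determined by `C_s`,
`μ(A ∩ R_X) μ(B ∩ R_Y) ≤ μ(A ∩ B ∩ R_{X∩Y}) μ(R_{X∪Y})` (`R_W = {s ↮ W}`), as the case `U = univ`,
`F = F_A`, `G = F_B` of the functional form `BHK2006.core`.
[cite: VandenbergHaggstromKahn2005, Thm. 1.1 (pp. 3–5)] -/
theorem bhkLogSupermodular_events (w : Sym2 V → unitInterval) (s : V) (X Y : Set V)
    (A B : Set (BondConfig V))
    (hA : ∀ ω ω', ω ∈ A → openEdgeCluster ω s ⊆ openEdgeCluster ω' s → ω' ∈ A)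
    (hB : ∀ ω ω', ω ∈ B → openEdgeCluster ω s ⊆ openEdgeCluster ω' s → ω' ∈ B) :
    (prodBernoulli w).real (A ∩ {ω | ∀ x ∈ X, ¬ (openGraph ω).Reachable s x}) *
        (prodBernoulli w).real (B ∩ {ω | ∀ y ∈ Y, ¬ (openGraph ω).Reachable s y}) ≤
      (prodBernoulli w).real (A ∩ B ∩ {ω | ∀ z ∈ X ∩ Y, ¬ (openGraph ω).Reachable s z}) *
        (prodBernoulli w).real {ω | ∀ z ∈ X ∪ Y, ¬ (openGraph ω).Reachable s z} := by
  set w' : Sym2 V → ℝ := fun e => (w e : ℝ)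
  have hw0 : ∀ e, 0 ≤ w' e := fun e => (w e).2.1
  have hw1 : ∀ e, w' e ≤ 1 := fun e => (w e).2.2
  have hm : ∑ ω, weight w' ω = 1 := by
    have h1 := integral_prodBernoulli_eq_sum w fun _ => (1 : ℝ)
    simp only [integral_const, probReal_univ, smul_eq_mul, mul_one] at h1
    exact h1.symm
  -- `U = univ`: the restricted quantities are the original ones
  have hE : ∀ ω : Set (Sym2 V), ω ∩ edgesIn (Finset.univ : Finset V) = ω := fun ω => by
    ext e
    simp only [Set.mem_inter_iff, edgesIn, Set.mem_setOf_eq, Finset.mem_univ, imp_true_iff,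
      and_true]
  have hC : ∀ ω, rC Finset.univ s ω = openEdgeCluster ω s := fun ω => by
    simp only [rC, hE]
  have hDD : ∀ W : Set V,
      rD Finset.univ s W = {ω | ∀ x ∈ W, ¬ (openGraph ω).Reachable s x} := fun W => by
    ext ω
    simp only [rD, hE, Set.mem_setOf_eq]
  have hXU : X ⊆ ↑(Finset.univ : Finset V) := by simp
  have hYU : Y ⊆ ↑(Finset.univ : Finset V) := by simp
  -- the functional Theorem 1.1 for `F_A`, `F_B`
  have key := core w' hw0 hw1 hm Finset.univ s (Finset.mem_univ s) X Y hXU hYU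
    (fun C => ind {C : Set (Sym2 V) | ∃ ω ∈ A, openEdgeCluster ω s ⊆ C} C)
    (fun C => ind {C : Set (Sym2 V) | ∃ ω ∈ B, openEdgeCluster ω s ⊆ C} C)
    (monotone_ind_setOf_exists_openEdgeCluster_subset A s)
    (monotone_ind_setOf_exists_openEdgeCluster_subset B s)
    (fun C => ind_nonneg _ C) (fun C => ind_nonneg _ C)
  simp only [hC, hDD, ind_setOf_exists_openEdgeCluster_subset hA,
    ind_setOf_exists_openEdgeCluster_subset hB] at key
  simpa only [prodBernoulli_real_eq_sum_weight_ind, ind_inter] using key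

end BHKEvents

/-- Registered stub `stub_bhkLogSupermodular` of crux stmt-CriticalPhenomena-4574 (line bhk-dyadic-thinning); see the line skeleton for the informal statement and sources. -/
theorem stub_bhkLogSupermodular :
    ∀ (n : ℕ) (w : Sym2 (Fin n) → unitInterval) (s : Fin n) (X Y : Set (Fin n))
      (A B : Set (Literature.Probability.Percolation.BondConfig (Fin n))),
      (∀ ω ω', ω ∈ A → Literature.Probability.Percolation.openEdgeCluster ω s ⊆
          Literature.Probability.Percolation.openEdgeCluster ω' s → ω' ∈ A) →
      (∀ ω ω', ω ∈ B → Literature.Probability.Percolation.openEdgeCluster ω s ⊆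
          Literature.Probability.Percolation.openEdgeCluster ω' s → ω' ∈ B) →
      s ∉ X → s ∉ Y →
      (Literature.Probability.LatticeModels.prodBernoulli w).real
          (A ∩ {ω | ∀ x ∈ X, ¬ (Literature.Probability.Percolation.openGraph ω).Reachable s x}) *
        (Literature.Probability.LatticeModels.prodBernoulli w).real
          (B ∩ {ω | ∀ y ∈ Y, ¬ (Literature.Probability.Percolation.openGraph ω).Reachable s y}) ≤
      (Literature.Probability.LatticeModels.prodBernoulli w).real
          (A ∩ B ∩ {ω | ∀ z ∈ X ∩ Y, ¬ (Literature.Probability.Percolation.openGraph ω).Reachable s z}) *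
        (Literature.Probability.LatticeModels.prodBernoulli w).real
          {ω | ∀ z ∈ X ∪ Y, ¬ (Literature.Probability.Percolation.openGraph ω).Reachable s z} := by
  intro n w s X Y A B hA hB _ _
  exact bhkLogSupermodular_events w s X Y A B hA hB

end Summit.CriticalPhenomena.PercolationContinuityZ3.Theorems
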